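import Literature.NumberTheory.EllipticCurves.SingularModuliCubeAwayFromTwo
import Literature.NumberTheory.EllipticCurves.EtaSexticThreeLevelNine
import Literature.NumberTheory.ModularForms.LevelThreeIdentities
import HarnessLib

/-!
# `(j(τ_{d_K}) − 1728)` is a square away from `3` — the primes above `2` included — for every
# imaginary quadratic field, through the level-`3` Hauptmodul `t = (η(τ)/η(3τ))¹²`
# (Weber, *Lehrbuch* III §72; Cox, *Primes of the form x² + ny²*, §12)

Topic `NumberTheory/EllipticCurves` (complex multiplication).  Theorem-only file (no definition, no
named fact).  Complement of `SingularModuliCubeSquareAwayFromSix.lean` (`2 ∣ v_𝔓(j₁ − 1728)` at the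
primes `𝔓 ∌ 2`): here **`2 ∣ v_𝔓(j₁ − 1728)` at every prime `𝔓 ∌ 3` of `𝓞_{H_K}`**, `j₁ ∈ 𝓞_{H_K}`
over `j(τ_{d_K})` (`two_dvd_count_span_formJ_sub_of_three_not_mem`), which covers the primes above
`2` — the case the Weber function `γ₃` cannot reach when `2 ∣ d_K`.

The mechanism is the parametrisation of `X₀(3)` by `t = (η(τ)/η(3τ))¹²`:
**`j(3τ)·t = (t + 27)(t + 3)³`, hence `(j(3τ) − 1728)·t = (t² + 18t − 27)²`**
(`kleinJ_mulThree_mul_tThree`, `kleinJ_mulThree_sub_mul_tThree`), obtained POINTWISE on `ℍ` from the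
tree's level-`3` identities `E₄(3τ)(t + 27) = 𝓟²(t + 3)`, `𝓟³t = Δ₃(t + 27)²`
(`LevelThreeIdentities.lean`) — multiplied out to `(t+27)³·[E₄(3τ)³t² − Δ₃²(t+27)(t+3)³] = 0` and
freed of the factor `(t + 27)³` by analytic continuation (`eq_zero_of_mul_eq_zero_of_mdifferentiable`).
At the CM point `τ_Q` of level `9` with `3τ_Q = τ_{d_K}` (`Q = (9, 9b, c)` or `(9, 9b − 6, 1 − 3b + c)`),
`t₀ = t(τ_Q)` lies in `H_K(j(τ_Q))` (transport of the rational element `t ∈ ℚ(X₀(9))`,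
`EtaSexticThreeLevelNine.mapLaurent_tNineFn`), is an algebraic integer dividing `3⁶` (root of the monic
quartic over `ℤ[j]`), and `H_K(j(τ_Q))/H_K` is unramified outside `3`
(`isUnramifiedIn_adjoin_formJ_conductor`, conductor `3`); so at a prime `𝔓 ∌ 3`,
`v_𝔓(j₁ − 1728) = 2·v_𝔔(t₀² + 18t₀ − 27)`.

## References

* D. A. Cox, *Primes of the form x² + ny²*, 2nd ed. (2013), §12.A (orders of conductor `3`, proof of
  Thm. 12.2), §11.B–C. [Cox2013]
* G. Shimura, *Introduction to the arithmetic theory of automorphic functions* (1971), §6.8.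
  [ShimuraIATAF1971]
* Y. Zhou, Ramanujan J. 38 (2015), Remark 9 (the level-`3` identities, as vendored in
  `LevelThreeIdentities.lean`). [Zhou2015]
* J. Neukirch, *Algebraic Number Theory* (1999), Ch. I §8. [NeukirchANT1999]
-/

noncomputable section

open Complex Polynomial IntermediateField NumberField IsDedekindDomain Filter Topology
open UpperHalfPlane hiding I
open scoped MatrixGroups Modular Cardinal ModularForm Manifold

namespace Literature.NumberTheory.EllipticCurves

universe u v

open ModularForms CongruenceSubgroup
open Literature.NumberTheory.NumberFields
open Literature.NumberTheory.ModularForms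
open Literature.FieldTheory.AlgClosed
open Literature.NumberTheory.QuadraticFields.BinaryQuadraticForm
open Literature.NumberTheory.QuadraticFields.Quadratic (discr_emod_four)

/-! ### Analytic continuation off the zeros of a holomorphic factor -/

/-- If `F·G = 0` on the upper half-plane for holomorphic `F, G` and `G(z₀) ≠ 0` somewhere, then
`F = 0` (identity theorem on the connected open set `{Im > 0}`). [folklore] -/
theorem eq_zero_of_mul_eq_zero_of_differentiableOn {F G : ℂ → ℂ}
    (hF : DifferentiableOn ℂ F {z : ℂ | 0 < z.im}) (hG : DifferentiableOn ℂ G {z : ℂ | 0 < z.im})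
    (hFG : ∀ z : ℂ, 0 < z.im → F z * G z = 0) {z₀ : ℂ} (hz₀ : 0 < z₀.im) (hG0 : G z₀ ≠ 0) :
    ∀ z : ℂ, 0 < z.im → F z = 0 := by
  have hUo : IsOpen {z : ℂ | 0 < z.im} := isOpen_lt continuous_const Complex.continuous_im
  have hFan : AnalyticOnNhd ℂ F {z : ℂ | 0 < z.im} := hF.analyticOnNhd hUo
  have hpre : IsPreconnected {z : ℂ | 0 < z.im} := (convex_halfSpace_im_gt 0).isPreconnected
  have hGc : ContinuousAt G z₀ := (hG.differentiableAt (hUo.mem_nhds hz₀)).continuousAt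
  have hev : ∀ᶠ w in 𝓝 z₀, G w ≠ 0 := hGc.eventually_ne hG0
  have hevU : ∀ᶠ w in 𝓝 z₀, w ∈ {z : ℂ | 0 < z.im} := hUo.mem_nhds hz₀
  have hF0 : F =ᶠ[𝓝 z₀] 0 := (hev.and hevU).mono fun w hw ↦
    (mul_eq_zero.mp (hFG w hw.2)).resolve_right hw.1
  have h := hFan.eqOn_zero_of_preconnected_of_eventuallyEq_zero hpre hz₀ hF0
  exact fun z hz ↦ h hz

/-- The `ℍ`-version: `f·g = 0` with `f, g` holomorphic on `ℍ` and `g(τ₀) ≠ 0` forces `f = 0`. [folklore] -/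
theorem eq_zero_of_mul_eq_zero_of_mdifferentiable {f g : ℍ → ℂ} (hf : MDifferentiable 𝓘(ℂ) 𝓘(ℂ) f)
    (hg : MDifferentiable 𝓘(ℂ) 𝓘(ℂ) g) (hfg : ∀ τ : ℍ, f τ * g τ = 0) {τ₀ : ℍ} (hg0 : g τ₀ ≠ 0)
    (τ : ℍ) : f τ = 0 := by
  have hF := UpperHalfPlane.mdifferentiable_iff.mp hf
  have hG := UpperHalfPlane.mdifferentiable_iff.mp hg
  have h := eq_zero_of_mul_eq_zero_of_differentiableOn hF hG (fun z _ ↦ hfg (ofComplex z)) τ₀.2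
    (by rw [Function.comp_apply, ofComplex_apply]; exact hg0) τ τ.2
  rwa [Function.comp_apply, ofComplex_apply] at h

/-! ### The level-`3` parametrisation: `j(3τ)·t = (t + 27)(t + 3)³` -/

section LevelThree

/-- `mulThree τ = tpD 3 • τ`. [folklore] -/
theorem mulThree_eq_tpD_smul (τ : ℍ) : mulThree τ = tpD 3 • τ :=
  UpperHalfPlane.ext (by rw [coe_mulThree, coe_tpD_smul]; push_cast; ring)

/-- `τ ↦ E₄(3τ)` is the form `E₄ThreeNine`. [folklore] -/
theorem E₄_mulThree_eq : (fun τ : ℍ ↦ ModularForm.E₄ (mulThree τ)) = ⇑E₄ThreeNine := by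
  funext τ; rw [E₄ThreeNine_apply, mulThree_eq_tpD_smul]

/-- **`E₄(3τ)³ t² = Δ₃² (t + 27)(t + 3)³`** on `ℍ`: from `E₄(3τ)(t + 27) = 𝓟²(t + 3)` and
`𝓟³t = Δ₃(t + 27)²` one gets `(t + 27)³ · (E₄(3τ)³t² − Δ₃²(t+27)(t+3)³) = 0`, and `t + 27 ≢ 0`
(`t(i/√3) = 27`). [cite: Zhou2015, Remark 9] -/
theorem E₄_mulThree_cube_mul_tThree_sq (τ : ℍ) :
    ModularForm.E₄ (mulThree τ) ^ 3 * tThree τ ^ 2 = deltaThree τ ^ 2 * (tThree τ + 27) * (tThree τ + 3) ^ 3 := by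
  set f : ℍ → ℂ := fun τ ↦ ModularForm.E₄ (mulThree τ) ^ 3 * tThree τ ^ 2 -
    deltaThree τ ^ 2 * (tThree τ + 27) * (tThree τ + 3) ^ 3 with hf
  set g : ℍ → ℂ := fun τ ↦ (tThree τ + 27) ^ 3 with hg
  have hE : MDifferentiable 𝓘(ℂ) 𝓘(ℂ) (fun τ : ℍ ↦ ModularForm.E₄ (mulThree τ)) := by
    rw [E₄_mulThree_eq]; exact E₄ThreeNine.holo'
  have hEd := UpperHalfPlane.mdifferentiable_iff.mp hE
  have htd := UpperHalfPlane.mdifferentiable_iff.mp mdifferentiable_tThree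
  have hΔd : DifferentiableOn ℂ (deltaThree ∘ ofComplex) {z : ℂ | 0 < z.im} :=
    fun z hz ↦ (differentiableAt_deltaThree hz).differentiableWithinAt
  have hfd : MDifferentiable 𝓘(ℂ) 𝓘(ℂ) f := by
    rw [UpperHalfPlane.mdifferentiable_iff]
    have : f ∘ ofComplex = fun w ↦ ((fun τ : ℍ ↦ ModularForm.E₄ (mulThree τ)) ∘ ofComplex) w ^ 3 *
        (tThree ∘ ofComplex) w ^ 2 - (deltaThree ∘ ofComplex) w ^ 2 *
          ((tThree ∘ ofComplex) w + 27) * ((tThree ∘ ofComplex) w + 3) ^ 3 := by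
      funext w; simp [hf]
    rw [this]
    exact ((hEd.pow 3).mul (htd.pow 2)).sub
      (((hΔd.pow 2).mul (htd.add_const 27)).mul ((htd.add_const 3).pow 3))
  have hgd : MDifferentiable 𝓘(ℂ) 𝓘(ℂ) g := by
    rw [UpperHalfPlane.mdifferentiable_iff]
    have : g ∘ ofComplex = fun w ↦ ((tThree ∘ ofComplex) w + 27) ^ 3 := by
      funext w; simp [hg]
    rw [this]
    exact (htd.add_const 27).pow 3
  have hfg : ∀ σ : ℍ, f σ * g σ = 0 := by
    intro σ
    have hA := E₄_mulThree_mul_tThree_add σ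
    have hB := eisThree_cube_mul_tThree σ
    simp only [hf, hg]
    linear_combination (tThree σ ^ 2 * (ModularForm.E₄ (mulThree σ) ^ 2 * (tThree σ + 27) ^ 2 +
        ModularForm.E₄ (mulThree σ) * (tThree σ + 27) * (eisThree σ ^ 2 * (tThree σ + 3)) +
        (eisThree σ ^ 2 * (tThree σ + 3)) ^ 2)) * hA +
      ((tThree σ + 3) ^ 3 * (eisThree σ ^ 3 * tThree σ + deltaThree σ * (tThree σ + 27) ^ 2)) * hB
  have hg0 : g (axisPt (1 / Real.sqrt 3)) ≠ 0 := by
    simp only [hg, tThree_axisPt_inv_sqrt_three]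
    norm_num
  have h := eq_zero_of_mul_eq_zero_of_mdifferentiable hfd hgd hfg hg0 τ
  simp only [hf] at h
  exact sub_eq_zero.mp h

/-- `Δ₃² = t · η(3τ)²⁴ = t · Δ(3τ)`. [folklore] -/
theorem deltaThree_sq_eq (τ : ℍ) :
    deltaThree τ ^ 2 = tThree τ * η (3 * (τ : ℂ)) ^ 24 := by
  have hη := eta_three_mul_ne_zero τ
  rw [deltaThree, tThree, coe_mulThree]
  field_simp

/-- **`j(3τ) · t(τ) = (t(τ) + 27)(t(τ) + 3)³`**, `t = (η(τ)/η(3τ))¹²` — the parametrisation of `X₀(3)`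
by its Hauptmodul. [cite: Cox2013, §12.A (orders of conductor `3`) and §11.B (11.15)] -/
theorem kleinJ_mulThree_mul_tThree (τ : ℍ) :
    kleinJ (mulThree τ) * tThree τ = (tThree τ + 27) * (tThree τ + 3) ^ 3 := by
  have hη := eta_three_mul_ne_zero τ
  have ht := tThree_ne_zero τ
  have h := E₄_mulThree_cube_mul_tThree_sq τ
  rw [deltaThree_sq_eq] at h
  have h2 : tThree τ * (ModularForm.E₄ (mulThree τ) ^ 3 * tThree τ -
      η (3 * (τ : ℂ)) ^ 24 * (tThree τ + 27) * (tThree τ + 3) ^ 3) = 0 := by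
    linear_combination h
  have h3 : ModularForm.E₄ (mulThree τ) ^ 3 * tThree τ = η (3 * (τ : ℂ)) ^ 24 * (tThree τ + 27) * (tThree τ + 3) ^ 3 :=
    sub_eq_zero.mp ((mul_eq_zero.mp h2).resolve_left ht)
  have hΔ : ModularForm.discriminant (mulThree τ) = η (3 * (τ : ℂ)) ^ 24 := by
    rw [ModularForm.discriminant, coe_mulThree]
  rw [kleinJ, hΔ, div_mul_eq_mul_div, h3]
  field_simp

/-- **`(j(3τ) − 1728) · t(τ) = (t(τ)² + 18 t(τ) − 27)²`.** [cite: Cox2013, §12.A] -/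
theorem kleinJ_mulThree_sub_mul_tThree (τ : ℍ) :
    (kleinJ (mulThree τ) - 1728) * tThree τ = (tThree τ ^ 2 + 18 * tThree τ - 27) ^ 2 := by
  linear_combination kleinJ_mulThree_mul_tThree τ

/-- `tNineValue = tThree` (the same function `(η(τ)/η(3τ))¹²`). [folklore] -/
theorem tNineValue_eq_tThree (τ : ℍ) : tNineValue τ = tThree τ := by
  rw [tNineValue, tThree, coe_mulThree]

end LevelThree

/-! ### Transport: `Aut(ℂ)` fixing `√D` and `j(τ_Q)` fixes `t(τ_Q)` at the level-`9` points -/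

section Transport

variable {b c : ℤ}

/-- Level-`9` transport at `τ_{(9, 9b, c)}`, `3 ∤ c`: an automorphism fixing `√D`, `D = 9b² − 4c`, and
`j(τ_Q)` fixes `t(τ_Q)`. [cite: ShimuraIATAF1971, §6.8 and Thm. 6.31] -/
theorem apply_tNineValue_nine_eq (hD : 9 * b ^ 2 - 4 * c < 0) (hc : ¬ (3 : ℤ) ∣ c)
    {σ : ℂ ≃+* ℂ} (hσ : σ (sqrtDisc (9 * b ^ 2 - 4 * c)) = sqrtDisc (9 * b ^ 2 - 4 * c))
    (hx : σ (formJ ((9 : ℤ), 9 * b, c)) = formJ ((9 : ℤ), 9 * b, c)) :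
    σ (tNineValue (heegnerTau ((9 : ℤ), 9 * b, c))) = tNineValue (heegnerTau ((9 : ℤ), 9 * b, c)) := by
  have hσ9 : σ (sqrtDisc (9 * (9 * b ^ 2 - 4 * c))) = sqrtDisc (9 * (9 * b ^ 2 - 4 * c)) := by
    rw [sqrtDisc_nine_mul, map_mul, map_ofNat, hσ]
  have hT := levelTransport_self_of_apply_formJ_eq_of_fst_eq (N := 9) (by linarith)
    (nine_mem_heegnerForms hc) rfl (isCoprime_nine_of_not_dvd hc) hσ9 hx
  exact LevelTransport.apply_value_eq (N := 9) hT (mapLaurent_tNineFn (σ : ℂ →+* ℂ))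
    (pointValuation_tNineFn_sub_lt_one _)

/-- Level-`9` transport at `τ_{(9, 9b−6, 1−3b+c)}`, `3 ∣ c`. [cite: ShimuraIATAF1971, §6.8 and Thm. 6.31] -/
theorem apply_tNineValue_shift_eq (hD : 9 * b ^ 2 - 4 * c < 0) (hc : (3 : ℤ) ∣ c)
    {σ : ℂ ≃+* ℂ} (hσ : σ (sqrtDisc (9 * b ^ 2 - 4 * c)) = sqrtDisc (9 * b ^ 2 - 4 * c))
    (hx : σ (formJ ((9 : ℤ), 9 * b - 6, 1 - 3 * b + c)) = formJ ((9 : ℤ), 9 * b - 6, 1 - 3 * b + c)) :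
    σ (tNineValue (heegnerTau ((9 : ℤ), 9 * b - 6, 1 - 3 * b + c))) =
      tNineValue (heegnerTau ((9 : ℤ), 9 * b - 6, 1 - 3 * b + c)) := by
  have hσ9 : σ (sqrtDisc (9 * (9 * b ^ 2 - 4 * c))) = sqrtDisc (9 * (9 * b ^ 2 - 4 * c)) := by
    rw [sqrtDisc_nine_mul, map_mul, map_ofNat, hσ]
  have hT := levelTransport_self_of_apply_formJ_eq_of_fst_eq (N := 9) (by linarith)
    (nine_shift_mem_heegnerForms hc) rfl (isCoprime_nine_of_not_dvd (not_three_dvd_shiftCoeff hc)) hσ9 hx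
  exact LevelTransport.apply_value_eq (N := 9) hT (mapLaurent_tNineFn (σ : ℂ →+* ℂ))
    (pointValuation_tNineFn_sub_lt_one _)

variable {K : Type*} [Field K] [NumberField K]

/-- **`t(τ_Q) ∈ H_K(j(τ_Q))`** for the level-`9` point `Q` over `τ₀ = τ_{(1, 3b, c)}` of discriminant
`d_K` — `Q = (9, 9b, c)` if `3 ∤ c`, `Q = (9, 9b − 6, 1 − 3b + c)` if `3 ∣ c`. [cite: ShimuraIATAF1971, §6.8 and Thm. 6.31] -/
theorem tNineValue_mem_adjoin (hK : IsImaginaryQuadratic K) (ι : K →+* ℂ)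
    (hdisc : 9 * b ^ 2 - 4 * c = NumberField.discr K) {Q : ℤ × ℤ × ℤ}
    (hQ : (¬ (3 : ℤ) ∣ c ∧ Q = ((9 : ℤ), 9 * b, c)) ∨ ((3 : ℤ) ∣ c ∧ Q = ((9 : ℤ), 9 * b - 6, 1 - 3 * b + c))) :
    tNineValue (heegnerTau Q) ∈ adjoin (singularModuliField K ι) ({formJ Q} : Set ℂ) := by
  set H := singularModuliField K ι with hHdef
  set x := formJ Q with hxdef
  have hD : 9 * b ^ 2 - 4 * c < 0 := by rw [hdisc]; exact hK.discr_neg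
  have hrange : Set.range (algebraMap H ℂ) = (H : Set ℂ) := by
    ext z; constructor
    · rintro ⟨y, rfl⟩; exact y.2
    · intro hz; exact ⟨⟨z, hz⟩, rfl⟩
  have hcount : #((adjoin H ({x} : Set ℂ)).toSubfield) ≤ ℵ₀ := by
    rw [adjoin_toSubfield]
    refine (Subfield.cardinalMk_closure_le_max _).trans (max_le ?_ le_rfl)
    refine (Cardinal.mk_union_le _ _).trans ?_
    rw [Cardinal.add_le_aleph0]
    exact ⟨Cardinal.mk_range_le.trans (cardinalMk_singularModuliField_le K hK ι), by simp⟩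
  refine Complex.mem_subfield_of_forall_ringEquiv _ hcount fun σ hσ ↦ ?_
  have hfixH : ∀ z ∈ H, σ z = z := fun z hz ↦
    hσ z (by
      show z ∈ (adjoin H ({x} : Set ℂ)).toSubfield
      rw [adjoin_toSubfield]
      exact Subfield.subset_closure (Or.inl (hrange ▸ hz)))
  have hσD : σ (sqrtDisc (9 * b ^ 2 - 4 * c)) = sqrtDisc (9 * b ^ 2 - 4 * c) := by
    have h := apply_sqrtDisc_discr_eq hK ι fun k ↦ hfixH _ (apply_mem_singularModuliField ι k)
    rwa [← hdisc] at h
  have hσx : σ x = x := hσ x (subset_adjoin H ({x} : Set ℂ) rfl)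
  rcases hQ with ⟨hc, rfl⟩ | ⟨hc, rfl⟩
  · exact apply_tNineValue_nine_eq hD hc hσD hσx
  · exact apply_tNineValue_shift_eq hD hc hσD hσx

end Transport

/-! ### Integrality of a root of a monic quartic with integral coefficients -/

/-- A root of `X⁴ + c₃X³ + c₂X² + c₁X + c₀` with integral coefficients is integral over `ℤ`. [folklore] -/
theorem isIntegral_of_quartic_eq_zero {x c₀ c₁ c₂ c₃ : ℂ} (h₀ : IsIntegral ℤ c₀) (h₁ : IsIntegral ℤ c₁)
    (h₂ : IsIntegral ℤ c₂) (h₃ : IsIntegral ℤ c₃)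
    (h : x ^ 4 + c₃ * x ^ 3 + c₂ * x ^ 2 + c₁ * x + c₀ = 0) : IsIntegral ℤ x := by
  set A : Subalgebra ℤ ℂ := Algebra.adjoin ℤ {c₀, c₁, c₂, c₃} with hA
  haveI : Algebra.IsIntegral ℤ A := Algebra.IsIntegral.adjoin (by
    rintro y (rfl | rfl | rfl | rfl)
    exacts [h₀, h₁, h₂, h₃])
  have hc₀ : c₀ ∈ A := Algebra.subset_adjoin (by simp)
  have hc₁ : c₁ ∈ A := Algebra.subset_adjoin (by simp)
  have hc₂ : c₂ ∈ A := Algebra.subset_adjoin (by simp)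
  have hc₃ : c₃ ∈ A := Algebra.subset_adjoin (by simp)
  set p : Polynomial A := X ^ 4 + C (⟨c₃, hc₃⟩ : A) * X ^ 3 + C (⟨c₂, hc₂⟩ : A) * X ^ 2 +
    C (⟨c₁, hc₁⟩ : A) * X + C (⟨c₀, hc₀⟩ : A) with hp
  have hdeg3 : (C (⟨c₃, hc₃⟩ : A) * X ^ 3 + C (⟨c₂, hc₂⟩ : A) * X ^ 2 +
      C (⟨c₁, hc₁⟩ : A) * X + C (⟨c₀, hc₀⟩ : A)).degree < 4 := by
    refine (degree_add_le _ _).trans_lt (max_lt ((degree_add_le _ _).trans_lt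
      (max_lt ((degree_add_le _ _).trans_lt (max_lt ?_ ?_)) ?_)) ?_)
    · exact (degree_C_mul_X_pow_le _ _).trans_lt (by norm_num)
    · exact (degree_C_mul_X_pow_le _ _).trans_lt (by norm_num)
    · exact (degree_C_mul_X_le _).trans_lt (by norm_num)
    · exact degree_C_le.trans_lt (by norm_num)
  have hmonic : p.Monic := by
    have : p = X ^ 4 + (C (⟨c₃, hc₃⟩ : A) * X ^ 3 + C (⟨c₂, hc₂⟩ : A) * X ^ 2 +
        C (⟨c₁, hc₁⟩ : A) * X + C (⟨c₀, hc₀⟩ : A)) := by rw [hp]; ring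
    rw [this]
    exact (monic_X_pow 4).add_of_left (by rwa [degree_X_pow])
  have hroot : aeval x p = 0 := by
    rw [hp]
    simp only [map_add, map_mul, aeval_X_pow, aeval_C, aeval_X]
    exact h
  exact isIntegral_trans x ⟨p, hmonic, by rwa [aeval_def] at hroot⟩

/-! ### Main theorem -/

section Main

variable {K : Type} [Field K] [NumberField K]

/-- **`2 ∣ v_𝔓(j₁ − 1728)` for every prime `𝔓 ∌ 3` of `𝓞_{H_K}`** (in particular for the primes above
`2`), `j₁ ∈ 𝓞_{H_K}` over `j(τ_{d_K})`, `j₁ ≠ 1728`, for every imaginary quadratic `K`: with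
`9b² − 4c = d_K` and the level-`9` point `Q` (`3τ_Q = τ_{d_K}`), `t₀ = t(τ_Q) ∈ H_K(j(τ_Q))`
(unramified over `H_K` outside `3`), `(j₁ − 1728)·t₀ = (t₀² + 18t₀ − 27)²`, `t₀ ∣ 3⁶`.
[cite: Cox2013, §12.A] [cite: ShimuraIATAF1971, §6.8] [cite: NeukirchANT1999, Ch. I §8 Prop. 8.2] -/
theorem two_dvd_count_span_formJ_sub_of_three_not_mem (hK : IsImaginaryQuadratic K) (ι : K →+* ℂ)
    [NumberField (singularModuliField K ι)] (j₁ : 𝓞 (singularModuliField K ι))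
    (hj₁ : ((j₁ : singularModuliField K ι) : ℂ) = formJ (principalForm (NumberField.discr K)))
    (hj0 : j₁ - 1728 ≠ 0) (v : HeightOneSpectrum (𝓞 (singularModuliField K ι)))
    (hv : ((3 : ℕ) : 𝓞 (singularModuliField K ι)) ∉ v.asIdeal) :
    2 ∣ (Associates.mk v.asIdeal).count (Associates.mk (Ideal.span {j₁ - 1728})).factors := by
  set D := NumberField.discr K with hDdef
  have hD : D < 0 := hK.discr_neg
  have h4 : D % 4 = 0 ∨ D % 4 = 1 := discr_emod_four hK.1
  have hP1 : 0 < (principalForm D).1 := by rw [principalForm_fst]; exact one_pos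
  have hjint : IsIntegral ℤ (formJ (principalForm D)) :=
    isIntegral_int_formJ hP1 (isPrimitive_principalForm D) (by rw [discr_principalForm h4]; exact hD)
  have h3pow : ∀ m : ℕ, ((3 : ℕ) : 𝓞 (singularModuliField K ι)) ^ m ∉ v.asIdeal :=
    fun m h ↦ hv (v.isPrime.mem_of_pow_mem m h)
  -- `τ₀ = τ_{(1, 3b, c)}` with `9b² − 4c = d_K`
  obtain ⟨b, c, hbc⟩ : ∃ b c : ℤ, 9 * b ^ 2 - 4 * c = D := by
    rcases h4 with h | h
    · exact ⟨0, -(D / 4), by omega⟩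
    · exact ⟨-1, (9 - D) / 4, by omega⟩
  have hD' : 9 * b ^ 2 - 4 * c < 0 := hbc ▸ hD
  -- the level-`9` point `Q` with `3τ_Q ∈ τ₀ + ℤ`
  obtain ⟨Q, hQ, hA9, hprim9, hdisc9, h3Q⟩ : ∃ Q : ℤ × ℤ × ℤ,
      ((¬ (3 : ℤ) ∣ c ∧ Q = ((9 : ℤ), 9 * b, c)) ∨ ((3 : ℤ) ∣ c ∧ Q = ((9 : ℤ), 9 * b - 6, 1 - 3 * b + c))) ∧
      0 < Q.1 ∧ IsPrimitive Q ∧ discr Q = 9 * (9 * b ^ 2 - 4 * c) ∧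
      kleinJ (mulThree (heegnerTau Q)) = formJ (principalForm D) := by
    by_cases hc : (3 : ℤ) ∣ c
    · obtain ⟨hA, hprim, hdisc⟩ := nine_shift_spec (b := b) hc
      refine ⟨_, Or.inr ⟨hc, rfl⟩, hA, hprim, hdisc, ?_⟩
      rw [mulThree_eq_tpD_smul, tpD_three_smul_heegnerTau_shift hD', ← formJ_eq_kleinJ,
        formJ_one_eq_formJ_principalForm (by nlinarith)]
      congr 1
      rw [show (3 * b - 2) ^ 2 - 4 * (1 - 3 * b + c) = D by rw [← hbc]; ring]
    · obtain ⟨hA, hprim, hdisc⟩ := nine_spec (b := b) hc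
      refine ⟨_, Or.inl ⟨hc, rfl⟩, hA, hprim, hdisc, ?_⟩
      rw [mulThree_eq_tpD_smul, tpD_three_smul_heegnerTau hD', ← formJ_eq_kleinJ,
        formJ_one_eq_formJ_principalForm (by nlinarith)]
      congr 1
      rw [show (3 * b) ^ 2 - 4 * c = D by rw [← hbc]; ring]
  set x := formJ Q with hxdef
  set M : IntermediateField (singularModuliField K ι) ℂ :=
    adjoin (singularModuliField K ι) ({x} : Set ℂ) with hMdef
  have h9D : 9 * (9 * b ^ 2 - 4 * c) < 0 := by linarith
  have hxint : IsIntegral ℤ x := isIntegral_int_formJ hA9 hprim9 (by rw [hdisc9]; exact h9D)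
  haveI : FiniteDimensional (singularModuliField K ι) M :=
    adjoin.finiteDimensional (show IsIntegral ℚ x from hxint.tower_top).tower_top
  haveI : FiniteDimensional ℚ M := Module.Finite.trans (singularModuliField K ι) M
  haveI : NumberField M := NumberField.mk
  -- `t₀ = t(τ_Q) ∈ M`, `(j₁ − 1728) t₀ = (t₀² + 18 t₀ − 27)²`, `j₁ t₀ = (t₀ + 27)(t₀ + 3)³`
  set t₀ := tNineValue (heegnerTau Q) with ht₀def
  have ht₀M : t₀ ∈ M := tNineValue_mem_adjoin hK ι hbc hQ
  have hrel1 : formJ (principalForm D) * t₀ = (t₀ + 27) * (t₀ + 3) ^ 3 := by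
    rw [ht₀def, tNineValue_eq_tThree, ← h3Q]
    exact kleinJ_mulThree_mul_tThree _
  have hrel : (formJ (principalForm D) - 1728) * t₀ = (t₀ ^ 2 + 18 * t₀ - 27) ^ 2 := by
    rw [ht₀def, tNineValue_eq_tThree, ← h3Q]
    exact kleinJ_mulThree_sub_mul_tThree _
  -- integrality: `t₀⁴ + 36 t₀³ + 270 t₀² + (756 − j) t₀ + 729 = 0`
  have hquartic : t₀ ^ 4 + 36 * t₀ ^ 3 + 270 * t₀ ^ 2 + (756 - formJ (principalForm D)) * t₀ + 729 = 0 := by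
    linear_combination -hrel1
  have ht₀int : IsIntegral ℤ t₀ :=
    isIntegral_of_quartic_eq_zero (isIntegral_natCast 729) ((isIntegral_natCast 756).sub hjint)
      (isIntegral_natCast 270) (isIntegral_natCast 36) (by exact_mod_cast hquartic)
  set u₀ : ℂ := -(t₀ ^ 3 + 36 * t₀ ^ 2 + 270 * t₀ + (756 - formJ (principalForm D))) with hu₀def
  have hst : t₀ * u₀ = 729 := by rw [hu₀def]; linear_combination -hquartic
  have hu₀int : IsIntegral ℤ u₀ :=
    ((((ht₀int.pow 3).add ((isIntegral_natCast 36).mul (ht₀int.pow 2))).add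
      ((isIntegral_natCast 270).mul ht₀int)).add ((isIntegral_natCast 756).sub hjint)).neg
  have hjM : formJ (principalForm D) ∈ M := by
    have : formJ (principalForm D) ∈ singularModuliField K ι := by
      rw [← hj₁]; exact (j₁ : singularModuliField K ι).2
    exact (algebraMap (singularModuliField K ι) M ⟨_, this⟩).2
  have hu₀M : u₀ ∈ M := by
    rw [hu₀def]
    refine neg_mem (add_mem (add_mem (add_mem (pow_mem ht₀M 3) (mul_mem ?_ (pow_mem ht₀M 2)))
      (mul_mem ?_ ht₀M)) (sub_mem ?_ hjM))
    · exact_mod_cast _root_.natCast_mem M 36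
    · exact_mod_cast _root_.natCast_mem M 270
    · exact_mod_cast _root_.natCast_mem M 756
  have htI : IsIntegral ℤ (⟨t₀, ht₀M⟩ : M) :=
    (isIntegral_algHom_iff (M.val.restrictScalars ℤ) Subtype.val_injective).mp ht₀int
  have huI : IsIntegral ℤ (⟨u₀, hu₀M⟩ : M) :=
    (isIntegral_algHom_iff (M.val.restrictScalars ℤ) Subtype.val_injective).mp hu₀int
  set t' : 𝓞 M := ⟨⟨t₀, ht₀M⟩, htI⟩ with ht'
  set u' : 𝓞 M := ⟨⟨u₀, hu₀M⟩, huI⟩ with hu'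
  have hinj : Function.Injective ((algebraMap M ℂ).comp (algebraMap (𝓞 M) M)) :=
    (algebraMap M ℂ).injective.comp RingOfIntegers.coe_injective
  have hg : algebraMap (𝓞 (singularModuliField K ι)) (𝓞 M) (j₁ - 1728) * t' ^ 1 =
      (t' ^ 2 + 18 * t' - 27) ^ 2 := by
    apply hinj
    simp only [RingHom.coe_comp, Function.comp_apply, map_mul, map_pow, map_add, map_sub, map_ofNat,
      pow_one]
    have h1 : algebraMap M ℂ (algebraMap (𝓞 M) M
        (algebraMap (𝓞 (singularModuliField K ι)) (𝓞 M) j₁)) =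
        ((j₁ : singularModuliField K ι) : ℂ) := rfl
    have h2 : algebraMap M ℂ (algebraMap (𝓞 M) M t') = t₀ := rfl
    rw [h1, h2, hj₁]
    exact hrel
  have hst' : t' * u' = algebraMap (𝓞 (singularModuliField K ι)) (𝓞 M)
      (((3 : ℕ) : 𝓞 (singularModuliField K ι)) ^ 6) := by
    apply hinj
    simp only [RingHom.coe_comp, Function.comp_apply, map_mul, map_pow, map_natCast]
    have h2 : algebraMap M ℂ (algebraMap (𝓞 M) M t') = t₀ := rfl
    have h3 : algebraMap M ℂ (algebraMap (𝓞 M) M u') = u₀ := rfl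
    rw [h2, h3, hst]
    norm_num
  -- `M/H_K` is unramified at `v ∌ 3`
  haveI := v.isMaximal
  have hdisc9' : discr Q = ((3 : ℕ) : ℤ) ^ 2 * NumberField.discr K := by
    rw [hdisc9, ← hDdef, ← hbc]; push_cast; ring
  have hunr : Algebra.IsUnramifiedIn (𝓞 M) v.asIdeal :=
    isUnramifiedIn_adjoin_formJ_conductor (Q := Q) hK ι (f := 3) (by norm_num) hA9 hprim9 hdisc9'
      v.asIdeal hv
  exact dvd_count_of_mul_pow_eq_pow_of_isUnramifiedIn (F := singularModuliField K ι) (L := M) hj0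
    hg hst' v (h3pow 6) hunr

end Main

end Literature.NumberTheory.EllipticCurves

end
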